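import Literature.MathematicalPhysics.QuantumFieldTheory.ConformalBootstrap3D.PointKernelK34v2Data
import Literature.MathematicalPhysics.QuantumFieldTheory.ConformalBootstrap3D.PointKernelParts

/-!
# K34v2 certificate, kernel part file P38: one-cell head segments 149, 150 in level ranges

The head cells whose kernel evaluation exceeds one `decide` are one-cell segments of `hsegsK34v2`; each is
checked by `PCert.hPartSideOK` (side conditions) and `PCert.hPartOK` per level range `[n_lo, n_lo + count)`
against an integer claim, the claims summing to `≥ 0` (`PointKernel.partsOK`); soundness is
`PCert.hParts_sound` (`PointKernelParts`).  The part files `P1, P2, …` are mutually independent (each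
imports only the data file); the ranges of one cell may span several of them, and the per-cell
conclusions `hparts_i` / `hcell_i` of those cells are assembled in `PointKernelK34v2.lean`.
Estimated kernel time 243 s.
-/

set_option maxRecDepth 100000
set_option maxHeartbeats 0

namespace Literature.MathematicalPhysics.QuantumFieldTheory.ConformalBootstrap3D.PointKernelK34v2

open Literature.MathematicalPhysics.QuantumFieldTheory.ConformalBootstrap3D.PointKernel

/-- levels `[40, 49)` of segment 149: partial lower sum `≥` claim. [folklore] -/
theorem part_149_2 : certK34v2.hPartOK (PCert.segAt hsegsK34v2 149) JHK34v2 40 9 (6570996968867781136147223231837821193) = true := by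
  decide +kernel

/-- levels `[49, 56)` of segment 149: partial lower sum `≥` claim. [folklore] -/
theorem part_149_3 : certK34v2.hPartOK (PCert.segAt hsegsK34v2 149) JHK34v2 49 7 (2118986505206675442542438865110194096) = true := by
  decide +kernel

/-- levels `[56, 61)` of segment 149: partial lower sum `≥` claim. [folklore] -/
theorem part_149_4 : certK34v2.hPartOK (PCert.segAt hsegsK34v2 149) JHK34v2 56 5 (751744506990587439944420499395599256) = true := by
  decide +kernel

/-- levels `[61, 65)` of segment 149: partial lower sum `≥` claim. [folklore] -/
theorem part_149_5 : certK34v2.hPartOK (PCert.segAt hsegsK34v2 149) JHK34v2 61 4 (346977813276584942478545354092206966) = true := by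
  decide +kernel

/-- one-cell segment 150 (row 6, cell `[1793/256, 14345/2048]`, chord, `n_F = 64`,
6 level ranges): side conditions. [folklore] -/
theorem pside_150 : certK34v2.hPartSideOK (PCert.segAt hsegsK34v2 150) JHK34v2 = true := by
  decide +kernel

/-- its level ranges `(n_lo, count, claim)`. [folklore] -/
def parts_150 : List (ℕ × ℕ × ℤ) := [(0, 28, -33386669141010679234564774755226446906), (28, 12, 23688092127792846353670774906357691601), (40, 9, 6549743961089371376082056927500935622), (49, 7, 2096357338133860889932302380739794396), (56, 5, 728685581628635247714205209238060329), (61, 4, 323790132365965367165435331389964963)]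

/-- the ranges tile `[0, n_F]` and the claims sum to `≥ 0`. [folklore] -/
theorem pcov_150 : PointKernel.partsOK 64 parts_150 = true := by
  decide +kernel

end Literature.MathematicalPhysics.QuantumFieldTheory.ConformalBootstrap3D.PointKernelK34v2
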